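import Summits.HodgeConjecture.CorCM.MumfordTateRankOfCMAbelianVariety
import Literature.AlgebraicGeometry.Motives.MumfordTateRankTwo
import HarnessLib

/-!
# The bottom of the Mumford–Tate rank ladder, I: `dim MT(H¹(X)) ≥ 2` for every non-zero complex abelian variety,
# and the quadratic Hodge endomorphism attached to `dim MT(H¹(X)) = 2`

COR-CM (cell `pub-hodgecm2`, seat `b27` gen 28, count-neutral lane MT-RANK-TWO, variety-level file 1 of 2;
theorems only, no definition, no named fact; UNCONDITIONAL).  Sequel of `CorCM/MumfordTateRankOfCMAbelianVariety`
(gen 27: the TOP rung `dim MT(H¹(X)) = rdim X + 1`).  Here NO CM hypothesis is made: for an ARBITRARY complex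
abelian variety `X` with `0 < dim X`, the Mumford–Tate rank `dim MT(H¹(X)) = (BettiUniverse.hodge _ hX 1).mtRank`
satisfies

* `two_le_mtRank_hodge_one` — **`2 ≤ dim MT(H¹(X))`** (odd weight: `HodgeStructure.two_le_mtRank_of_odd`);
* `exists_end_of_mtRank_hodge_one_eq_two` — if `dim MT(H¹(X)) = 2` there is a RATIONAL endomorphism `x` of
  `H¹(X(ℂ); ℚ)` with a quadratic equation `x² = c + d x` over `ℚ` whose complexification has exactly the two
  eigenspaces `H^{1,0}` (eigenvalue `μ₁`) and `H^{0,1}` (eigenvalue `μ₀ = μ̄₁ ≠ μ₁`).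

File 2 (`CorCM/MumfordTateRankTwo.lean`) turns this into «`dim MT(H¹(X)) = 2 ⟺ X ∼ E^{dim X}`, `E` a CM elliptic
curve».

## Proof (the Lie-algebra shadow of Deligne I 3.4 / 3.7; folklore)

`Literature/AlgebraicGeometry/Motives/MumfordTateRankTwo` (F1): for a Hodge structure of odd weight with
`dim_ℚ 𝔪𝔱 = 2`, `𝔪𝔱 = ℚ·id ⊕ ℚ·x` with `x_ℂ = a + b·Θ`, `b ≠ 0` (`Θ` the grading operator).  On `H¹(X)` the
degrees are `0, 1` (effectivity), so `x_ℂ` has the two eigenspaces `H^{0,1}` (eigenvalue `μ₀ = a`) and `H^{1,0}`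
(`μ₁ = a + b`), with `μ̄₁ = μ₀ ≠ μ₁` (Hodge symmetry; `x` is rational).  The complex relation
`x_ℂ² = (μ₀+μ₁) x_ℂ − μ₀μ₁` descends to `ℚ` (`(span_ℚ{1,x}) ⊗ ℂ ∩ End_ℚ = span_ℚ{1,x}`,
`mem_of_one_tmul_mem_baseChange`): `x² = c + d x` with `c, d ∈ ℚ`.

## References

* [Deligne1982HodgeCycles] P. Deligne, *Hodge cycles on abelian varieties*, LNM 900 (1982), I Prop. 3.4, Ex. 3.7,
  §4–§5.
* [MoonenZarhin1999LowDim] B. Moonen, Yu. Zarhin, *Hodge classes on abelian varieties of low dimension*, Math.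
  Ann. 315 (1999), §2 (`X` is of CM type iff `Hg(X)` is commutative; `Hg(E) = U(1)` for a CM elliptic curve).
* [MumfordAV1970] D. Mumford, *Abelian Varieties* (1970), §1 (3) (`b₁ = 2g`).
-/

noncomputable section

open scoped TensorProduct
open CategoryTheory CategoryTheory.Limits NumberField Module

namespace Summit.HodgeConjecture.CorCM

open Literature.AlgebraicGeometry.Motives
open Literature.AlgebraicGeometry.Motives.AbelianVariety
open Literature.AlgebraicGeometry.Motives.HodgeStructure
open Literature.AlgebraicGeometry.HodgeTheory

/-! ## §1 `2 ≤ dim MT(H¹(X))` for every complex abelian variety of positive dimension -/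

section LowerBound

variable [HodgeTensorFacts.{0, 0}] {X : AbelianVariety ℂ} {n : ℕ}

omit [HodgeTensorFacts.{0, 0}] in
/-- `H¹(X(ℂ); ℚ) ≠ 0` when `dim X > 0` (`b₁ = 2 dim X`). [cite: MumfordAV1970, §1 (3)] -/
theorem nontrivial_bettiCohomology_one (h0 : 0 < X.dim) : Nontrivial (bettiCohomology X.X 1) := by
  apply Module.nontrivial_of_finrank_pos (R := ℚ)
  rw [finrank_bettiCohomology_one]
  omega

/-- **`2 ≤ dim MT(H¹(X))` for every complex abelian variety `X` with `0 < dim X`** — no CM hypothesis: the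
Mumford–Tate group contains the homotheties, and if it were reduced to them the weight-one Hodge structure
`H¹(X)` would be concentrated in a single bidegree, which is impossible in odd weight
(`HodgeStructure.two_le_mtRank_of_odd`). [cite: Deligne1982HodgeCycles, I Prop. 3.4 and Ex. 3.7] -/
theorem two_le_mtRank_hodge_one (hX : IsSmoothProjective n X.X) (h0 : 0 < X.dim) :
    haveI := BettiUniverse.finite hX 1
    2 ≤ (BettiUniverse.hodge exists_isReal_hodgeModel_holds hX 1).mtRank := by
  haveI := BettiUniverse.finite hX 1
  haveI := nontrivial_bettiCohomology_one h0
  exact HodgeStructure.two_le_mtRank_of_odd _ (by decide)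

end LowerBound

/-! ## §2 `dim MT(H¹(X)) = 2`: a rational endomorphism of `H¹` with eigenspaces `H^{1,0}`, `H^{0,1}` and a
quadratic minimal equation over `ℚ` -/

section RankTwo

variable [HodgeTensorFacts.{0, 0}] {X : AbelianVariety ℂ} {n : ℕ}

/-- **The endomorphism `x` of `H¹(X(ℂ); ℚ)` attached to `dim MT(H¹(X)) = 2`.**  There are `x ∈ End_ℚ H¹(X(ℂ); ℚ)`,
rationals `c, d` and complex numbers `μ₀ ≠ μ₁ = μ̄₀`... precisely: `x² = c + d x`; `μ₀ ≠ μ₁`; `conj μ₁ = μ₀`;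
both `μᵢ` satisfy `μ² = c + d μ`; every eigenvalue of `x_ℂ` is `μ₀` or `μ₁`; the `μ₁`-eigenvectors of `x_ℂ` are
the classes of Hodge type `(1,0)` and the `μ₀`-eigenvectors those of type `(0,1)` (F1 on the weight-one, effective
Hodge structure `H¹(X)`: `x_ℂ = a + b·Θ`, `μ₀ = a`, `μ₁ = a + b`; descent of `x_ℂ² = (μ₀+μ₁)x_ℂ − μ₀μ₁` to `ℚ`).
[cite: Deligne1982HodgeCycles, I Prop. 3.4 (proof), Ex. 3.7, §4] -/
theorem exists_end_of_mtRank_hodge_one_eq_two (hX : IsSmoothProjective n X.X) (h0 : 0 < X.dim)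
    (h2 : haveI := BettiUniverse.finite hX 1
      (BettiUniverse.hodge exists_isReal_hodgeModel_holds hX 1).mtRank = 2) :
    ∃ (x : Module.End ℚ (bettiCohomology X.X 1)) (c d : ℚ) (μ₀ μ₁ : ℂ),
      x * x = c • 1 + d • x ∧ μ₀ ≠ μ₁ ∧ starRingEnd ℂ μ₁ = μ₀ ∧
      μ₀ * μ₀ = (c : ℂ) + (d : ℂ) * μ₀ ∧ μ₁ * μ₁ = (c : ℂ) + (d : ℂ) * μ₁ ∧
      (∀ (t : ℂ ⊗[ℚ] bettiCohomology X.X 1) (l : ℂ), t ≠ 0 → x.baseChange ℂ t = l • t → l = μ₀ ∨ l = μ₁) ∧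
      (∀ t : ℂ ⊗[ℚ] bettiCohomology X.X 1, x.baseChange ℂ t = μ₁ • t →
        IsOfHodgeType n X.X 1 1 0 (ofRatClassBaseChange (ComplexPoints X.X) 1 t)) ∧
      (∀ t : ℂ ⊗[ℚ] bettiCohomology X.X 1, x.baseChange ℂ t = μ₀ • t →
        IsOfHodgeType n X.X 1 0 1 (ofRatClassBaseChange (ComplexPoints X.X) 1 t)) := by
  set hHD := exists_isReal_hodgeModel_holds
  have hI := hodgePQ_independent_of_hodgeModel_holds
  haveI := BettiUniverse.finite hX 1
  haveI := nontrivial_bettiCohomology_one h0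
  set V := bettiCohomology X.X 1
  set H := BettiUniverse.hodge hHD hX 1 with hHdef
  have hodd : Odd ((1 : ℕ) : ℤ) := by decide
  obtain ⟨S, deg, e, hF, hFc⟩ := exists_basis_F_eq_span H
  haveI : Fintype S := FiniteDimensional.fintypeBasisIndex e
  classical
  obtain ⟨x, -, -, -, a, b, hb, hx⟩ := exists_of_mtRank_eq_two_of_odd H hodd h2 e hF hFc
  -- degrees are `0` or `1` (effectivity of `H¹`)
  have hdeg : ∀ σ : S, deg σ = 0 ∨ deg σ = 1 := by
    intro σ
    have h := (BettiUniverse.hodge_isEffective hHD hX 1).deg_mem_Icc_of_graded e hF hFc σ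
    simp only [Nat.cast_one] at h
    omega
  -- both degrees occur
  obtain ⟨σ', τ', hστ⟩ := exists_deg_ne_of_odd H hodd e hF hFc
  have hex : ∀ q : ℤ, (q = 0 ∨ q = 1) → ∃ σ : S, deg σ = q := by
    intro q hq
    rcases hdeg σ' with h1 | h1 <;> rcases hdeg τ' with h2 | h2
    · exact absurd (h1.trans h2.symm) hστ
    · rcases hq with rfl | rfl
      exacts [⟨σ', h1⟩, ⟨τ', h2⟩]
    · rcases hq with rfl | rfl
      exacts [⟨τ', h2⟩, ⟨σ', h1⟩]
    · exact absurd (h1.trans h2.symm) hστ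
  have hpiece : ∀ q : ℤ, (q = 0 ∨ q = 1) → H.piece q ((1 : ℕ) - q) ≠ ⊥ := by
    intro q hq hbot
    obtain ⟨σ, hσ⟩ := hex q hq
    have hmem : e σ ∈ H.piece q (((1 : ℕ) : ℤ) - q) := by
      rw [piece_eq_span_of_graded H e hF hFc q]
      exact Submodule.subset_span ⟨σ, hσ, rfl⟩
    rw [hbot, Submodule.mem_bot] at hmem
    exact e.ne_zero σ hmem
  -- the two eigenvalues
  set μ₀ : ℂ := a + b * ((0 : ℤ) : ℂ) with hμ₀
  set μ₁ : ℂ := a + b * ((1 : ℤ) : ℂ) with hμ₁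
  have hne : μ₀ ≠ μ₁ := by
    intro h
    apply hb
    have : b * ((1 : ℤ) : ℂ) = b * ((0 : ℤ) : ℂ) := by
      have := congrArg (fun z => z - a) h
      simpa [hμ₀, hμ₁] using this.symm
    simpa using this
  have hconj : starRingEnd ℂ μ₁ = μ₀ := by
    have h := conj_eigenvalue_eq_of_piece_ne_bot H e hF hFc hx (p := 1) (hpiece 1 (Or.inr rfl))
    rw [hμ₁, hμ₀, h]
    norm_num
  -- eigenvectors of `x_ℂ` for `l`: the span of the basis vectors of degree `q` with `a + b q = l`
  have heig : ∀ (l : ℂ) (t : ℂ ⊗[ℚ] V), x.baseChange ℂ t = l • t →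
      t ∈ Submodule.span ℂ (e '' {σ | a + b * (deg σ : ℂ) - l = 0}) := by
    intro l t ht
    have hD : ∀ σ, (x.baseChange ℂ - l • 1) (e σ) = (a + b * (deg σ : ℂ) - l) • e σ := by
      intro σ
      rw [LinearMap.sub_apply, LinearMap.smul_apply, Module.End.one_apply, hx σ, sub_smul]
    rw [← ker_eq_span_of_diag e hD, LinearMap.mem_ker, LinearMap.sub_apply, LinearMap.smul_apply,
      Module.End.one_apply, ht, sub_self]
  have heig' : ∀ (q : ℤ) (t : ℂ ⊗[ℚ] V), x.baseChange ℂ t = (a + b * (q : ℂ)) • t →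
      t ∈ H.piece q (((1 : ℕ) : ℤ) - q) := by
    intro q t ht
    rw [piece_eq_span_of_graded H e hF hFc q]
    have h := heig _ t ht
    have hset : {σ : S | a + b * (deg σ : ℂ) - (a + b * (q : ℂ)) = 0} ⊆ {σ | deg σ = q} := by
      intro σ hσ
      simp only [Set.mem_setOf_eq] at hσ ⊢
      have h1 : b * ((deg σ : ℂ) - (q : ℂ)) = 0 := by rw [mul_sub]; linear_combination hσ
      rcases mul_eq_zero.1 h1 with h2 | h2
      · exact absurd h2 hb
      · exact_mod_cast sub_eq_zero.1 h2
    exact Submodule.span_mono (Set.image_mono hset) h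
  -- the quadratic relation over `ℂ`, then over `ℚ`
  set s : ℂ := μ₀ + μ₁ with hs
  set p : ℂ := μ₀ * μ₁ with hp
  have hrelC : (x * x).baseChange ℂ = s • x.baseChange ℂ - p • (1 : Module.End ℂ (ℂ ⊗[ℚ] V)) := by
    refine e.ext fun σ => ?_
    simp only [LinearMap.baseChange_mul, Module.End.mul_apply, hx σ, map_smul, smul_smul, LinearMap.sub_apply,
      LinearMap.smul_apply, Module.End.one_apply]
    rw [← sub_smul]
    congr 1
    rcases hdeg σ with h | h <;> rw [h] <;> simp only [hs, hp, hμ₀, hμ₁] <;> push_cast <;> ring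
  have hmemW : x * x ∈ Submodule.span ℚ ({1, x} : Set (Module.End ℚ V)) := by
    apply mem_of_one_tmul_mem_baseChange
    have key : ((1 : ℂ) ⊗ₜ[ℚ] (x * x) : ℂ ⊗[ℚ] Module.End ℚ V) =
        s • ((1 : ℂ) ⊗ₜ[ℚ] x) - p • ((1 : ℂ) ⊗ₜ[ℚ] (1 : Module.End ℚ V)) := by
      apply (endBaseChangeEquiv V).injective
      rw [map_sub, map_smul, map_smul, endBaseChangeEquiv_tmul, endBaseChangeEquiv_tmul,
        endBaseChangeEquiv_tmul, one_smul, one_smul, one_smul, hrelC]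
      simp only [Module.End.one_eq_id, LinearMap.baseChange_id]
    rw [key]
    exact Submodule.sub_mem _
      (Submodule.smul_mem _ _ (Submodule.tmul_mem_baseChange_of_mem 1
        (Submodule.subset_span (Set.mem_insert_of_mem _ rfl))))
      (Submodule.smul_mem _ _ (Submodule.tmul_mem_baseChange_of_mem 1
        (Submodule.subset_span (Set.mem_insert _ _))))
  obtain ⟨c, d, hcd⟩ := Submodule.mem_span_pair.1 hmemW
  -- evaluating `x² = c + d x` on eigenvectors: `μ² = c + d μ`
  have heval : ∀ σ : S, (a + b * (deg σ : ℂ)) * (a + b * (deg σ : ℂ)) = (c : ℂ) + (d : ℂ) * (a + b * (deg σ : ℂ)) := by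
    intro σ
    have h := congrArg (fun T : Module.End ℚ V => T.baseChange ℂ (e σ)) hcd
    simp only [LinearMap.baseChange_add, LinearMap.baseChange_smul, LinearMap.add_apply, LinearMap.smul_apply,
      LinearMap.baseChange_mul, Module.End.mul_apply, Module.End.one_eq_id, LinearMap.baseChange_id,
      LinearMap.id_apply, hx σ, map_smul] at h
    rw [← algebraMap_smul ℂ c (e σ), ← algebraMap_smul ℂ d] at h
    simp only [smul_smul] at h
    rw [← add_smul] at h
    have h' : ((algebraMap ℚ ℂ c + algebraMap ℚ ℂ d * (a + b * (deg σ : ℂ))) -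
        (a + b * (deg σ : ℂ)) * (a + b * (deg σ : ℂ))) • e σ = 0 := by
      rw [sub_smul, h, sub_self]
    rcases smul_eq_zero.1 h' with h3 | h3
    · have h4 := (sub_eq_zero.1 h3).symm
      rw [h4]
      simp
    · exact absurd h3 (e.ne_zero σ)
  have hroot : ∀ q : ℤ, (q = 0 ∨ q = 1) →
      (a + b * (q : ℂ)) * (a + b * (q : ℂ)) = (c : ℂ) + (d : ℂ) * (a + b * (q : ℂ)) := by
    intro q hq
    obtain ⟨σ, hσ⟩ := hex q hq
    rw [← hσ]
    exact heval σ
  refine ⟨x, c, d, μ₀, μ₁, hcd.symm, hne, hconj, hroot 0 (Or.inl rfl), hroot 1 (Or.inr rfl),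
    fun t l ht0 ht => ?_, fun t ht => ?_, fun t ht => ?_⟩
  · -- every eigenvalue is `μ₀` or `μ₁`
    by_contra hl
    push Not at hl
    apply ht0
    have h := heig l t ht
    have hempty : {σ : S | a + b * (deg σ : ℂ) - l = 0} = ∅ := by
      refine Set.eq_empty_of_forall_notMem fun σ hσ => ?_
      simp only [Set.mem_setOf_eq, sub_eq_zero] at hσ
      rcases hdeg σ with h0' | h1'
      · exact hl.1 (by rw [hμ₀, ← hσ, h0'])
      · exact hl.2 (by rw [hμ₁, ← hσ, h1'])
    rwa [hempty, Set.image_empty, Submodule.span_empty, Submodule.mem_bot] at h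
  · -- `μ₁`-eigenvectors are of type `(1,0)`
    have h := heig' 1 t ht
    have h' : t ∈ H.piece ((1 : ℕ) : ℤ) ((0 : ℕ) : ℤ) := by simpa using h
    exact (BettiUniverse.mem_hodge_piece_iff hHD hI hX (k := 1) (p := 1) (q := 0) rfl t).1 h'
  · -- `μ₀`-eigenvectors are of type `(0,1)`
    have h := heig' 0 t ht
    have h' : t ∈ H.piece ((0 : ℕ) : ℤ) ((1 : ℕ) : ℤ) := by simpa using h
    exact (BettiUniverse.mem_hodge_piece_iff hHD hI hX (k := 1) (p := 0) (q := 1) rfl t).1 h'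

end RankTwo

end Summit.HodgeConjecture.CorCM

end
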